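import Summits.BirchSwinnertonDyer.Rank1Residual.Additive.BudgetFromRationalClasses
import Summits.BirchSwinnertonDyer.Rank1Residual.AdditivePotMult.PotMultX3BranchPAdicValIdentityRouteG
import HarnessLib

/-!
# X3♯(M) Route-G ends with the budget from n1011-p10's LEVEL-`n` COUNT: `hbud` ↦ (Greenberg 1999
# Prop. 4.14 record BY NAME + `p ∤ #E(ℚ)_tors` + `p^{n₀} ≤ #A_n[p]` = "classes over `ℚ_n` everywhere
# locally trivial over `ℚ_∞`", `Additive.budgetLeLambdaAt_of_prop414_of_layerClasses`) — rank `0`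
# (`BSD(E,p)`: every odd `p` / Pal-free odd / `p = 3`; the `hnf` form on rows with rational `p`-torsion)
# and rank `1` (typed `p`-adic Gross–Zagier capstone; census-column valuation headline, `p = 3`)
# (cell `b2b-bsdres`, team n1011, seat p12 (gen 4): the X3♯(M) twin of p10's T-E3g-BUD0 FILE 1 §5,
# requested by p10 GEN 4, INBOX 2026-08-21T11:10Z (b) "YES PLEASE: p12 take the X3♯(M) `_of_layerClasses` ends")

HONEST FRAMING (cell `b2b-bsdres`, run/shared/lean/b2b/bsd-rank1-residual/, verbatim in every
file): the goal of the cell is to DELETE the COMBINATION-SHAPED residual classes of the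
Birch–Swinnerton-Dyer formula for ALL analytic-rank `≤ 1` elliptic curves over `ℚ` — "full BSD
formula for every rank `≤ 1` curve in class `C`" assembled STRICTLY from published theorems — so
that the rank-`≤ 1` remainder becomes exactly the CONSTRUCTION-SHAPED classes, which are TYPED
(missing-input `Prop`s), NOT attempted. This is not "finishing BSD". Team n1011: research routes on
CONSTRUCTION-SHAPED classes; prove what is provable now; no claim beyond stated classes; census
output = EVIDENCE, never a Literature fact; RESIDUAL-MAP marks UNCHANGED; nothing is booked by this
file. THEOREMS ONLY (one-liners over this seat's gen-2/3 `…_of_budget` ends and p10's level-`n`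
budget `budgetLeLambdaAt_of_prop414_of_layerClasses` / `…_of_noFiniteSubmodule_of_layerClasses`,
all consumed BY NAME); no definition, no named fact. X3 (REDUCIBLE `E[p]`) rows carry NO image /
irreducibility binder (cell rule R5-42 (b): the probe `example (h : ClassX3M W p) (hirr : Irr W p) :
False` is not applicable verbatim to `ClassX3M` — its reducibility clause is `h.1.1`-free — and no
`hirr` occurs below).

THE INPUT (p10's T-E3g-BUD0, `Additive/BudgetFromRationalClasses.lean`, p264381): with `E(ℚ)[p] = 0`
the classes `A_n ⊂ H¹(ℚ_n, E[p^∞])` that are everywhere locally trivial over `ℚ_∞` (Greenberg's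
`ker g_n`, tree `selmerInftyPreimage κ n`) INJECT into `Sel_{p^∞}(E/ℚ_∞)`; so a count
`hA : ∀ κ cyclotomic, ∃ s : Finset (A_n[p]), p^{n₀} ≤ s.card` (at `n = 0`: the Tamagawa / `Ш(E/ℚ)[p]`
classes over `ℚ` — Greenberg LNM 1716 Cor. 5.6's proof, r2 II.17; at `n = 1`: the `s_ℓ > 1` surplus,
the 406D1 example) gives the residual count and, with the Prop. 4.14 record (`h414`, `p ∤ #E(ℚ)_tors`)
or directly with (b′) `hnf : NoFiniteSubmoduleAt p W` (rows with rational `p`-torsion), the budget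
`BudgetLeLambdaAt p W n₀`. Referee 1 R12.1 / lead R5-44 (g): the Prop-4.14 budget is not instantiated
on O5/O6 (potentially supersingular) rows — no `Λ`-cotorsion input there; X3♯(M) rows are potentially
MULTIPLICATIVE, inside the printed case.

References: [GreenbergLNM1716] Prop. 4.14 (p. 114), §5 Cor. 5.6 (proof); [Wuthrich2014] Thm. 16;
[Delbourgo1998] Prop. 4; [Delbourgo2002] Theorem (B); [Pal2012] Thm. 3.2; [Miller2011LMS] Def. 1.1;
ROUTE-2 II.15.2, II.17; skel/T-E3g-BUD0.md (p10).
-/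

set_option autoImplicit false

noncomputable section

open scoped Classical MatrixGroups ModularForm NumberField

namespace Summit.BirchSwinnertonDyer.Rank1Residual.AdditivePotMult

open CongruenceSubgroup WeierstrassCurve NumberField Literature.NumberTheory.EllipticCurves
  Literature.NumberTheory.EllipticCurves.ModularForms
  Literature.NumberTheory.EllipticCurves.Rank1Residual
  Literature.NumberTheory.EllipticCurves.Rank1Residual.Typed
  Literature.NumberTheory.EllipticCurves.Delbourgo2002
  Literature.NumberTheory.GaloisRepresentations
  Summit.BirchSwinnertonDyer.Rank1Residual.Additive
  Summit.BirchSwinnertonDyer.Rank1Residual.Additive.CensusQ6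
  IsDedekindDomain

variable {W : WeierstrassCurve ℚ} [W.IsElliptic] [W.IsGloballyMinimal] {p : ℕ} [hp : Fact p.Prime]

/-! ### §1 Rank `0`: `BSD(E,p)` on X3♯(M) from the record + Prop. 4.14 + the level-`n` count -/

/-- **X3♯(M) ∧ `r_an = 0`, EVERY odd `p`: `BSD(E,p)`** from Wuthrich's half `hW16`, the Q6 record at
index `n₀` (parity pair), the Greenberg 1999 Prop. 4.14 record `h414` with `p ∤ #E(ℚ)_tors`, and p10's
LEVEL-`n` count `hA` (`p^{n₀}` classes over `ℚ_n` locally trivial over `ℚ_∞`) — this seat's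
`…_of_budget` end with `hbud := budgetLeLambdaAt_of_prop414_of_layerClasses h414 htors n hA`.
[cite: Wuthrich2014, Thm. 16 (p. 397)] [cite: Delbourgo1998, Prop. 4 (p. 144)]
[cite: GreenbergLNM1716, Prop. 4.14 (p. 114) and §5 Cor. 5.6 (proof)] [cite: Pal2012, Thm. 3.2] [cite: Miller2011LMS, Def. 1.1] -/
theorem ClassX3M.bsdp_rankZero_of_wuthrichHalf_of_firstUnitIndex_of_prop414_of_layerClasses
    (hW16 : Wuthrich2014.thm16_halfEigenCharIdeal_dvd_cyclotomicPrime)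
    (hDel : Delbourgo1998.prop4_rankZero_pow_dvd_constantCoeff)
    (hDelX : Delbourgo1998.prop4_rankZero_constantCoeff_eq_unit_mul_of_potMult)
    (hPal : Pal2012.thm32_sqrt_mul_realPeriodRat_twist_eq_of_prime_one_mod_four)
    (h414 : Greenberg1999.prop414_noFiniteSubmodule_of_not_dvd_torsionOrder)
    (hGZK : rank_eq_analyticRank_of_analyticRank_le_one) (hmod : hasEntireLFunction_rat)
    (hmodD : nonempty_modularParametrizationData)
    (hX : ClassX3M W p) (hr : W.analyticRank = 0) (htors : ¬ p ∣ W.torsionOrder) {n₀ : ℕ}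
    (hrec : (p % 4 = 1 → MultFirstUnitIndexAt W p n₀) ∧ (p % 4 = 3 → MultOddFirstUnitIndexAt W p n₀))
    (n : ℕ) (hA : ∀ (κ : ZpExtension ℚ p), κ.IsCyclotomic →
      ∃ s : Finset {y : W.selmerInftyPreimage κ n // p • y = 0}, p ^ n₀ ≤ s.card) : BSDp W p :=
  hX.bsdp_rankZero_of_wuthrichHalf_of_firstUnitIndex_of_budget hW16 hDel hDelX hPal hGZK hmod hmodD hr
    hrec (budgetLeLambdaAt_of_prop414_of_layerClasses h414 htors n hA)

/-- **Pal-free odd form, `p ≡ 3 (mod 4)`**: X3♯(M) ∧ `r_an = 0`, odd record `MultOddFirstUnitIndexAt W p n₀`,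
`h414` + `p ∤ #E(ℚ)_tors`, p10's level-`n` count ⟹ `BSD(E,p)`.
[cite: Wuthrich2014, Thm. 16 (p. 397)] [cite: Delbourgo1998, Prop. 4 (p. 144)]
[cite: GreenbergLNM1716, Prop. 4.14 (p. 114)] [cite: Miller2011LMS, Def. 1.1] -/
theorem ClassX3M.bsdp_rankZero_of_wuthrichHalf_of_firstUnitIndex_of_prop414_of_layerClasses_odd
    (hW16 : Wuthrich2014.thm16_halfEigenCharIdeal_dvd_cyclotomicPrime)
    (hDel : Delbourgo1998.prop4_rankZero_pow_dvd_constantCoeff)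
    (hDelX : Delbourgo1998.prop4_rankZero_constantCoeff_eq_unit_mul_of_potMult)
    (h414 : Greenberg1999.prop414_noFiniteSubmodule_of_not_dvd_torsionOrder)
    (hGZK : rank_eq_analyticRank_of_analyticRank_le_one) (hmod : hasEntireLFunction_rat)
    (hmodD : nonempty_modularParametrizationData)
    (hX : ClassX3M W p) (hp4 : p % 4 = 3) (hr : W.analyticRank = 0) (htors : ¬ p ∣ W.torsionOrder)
    {n₀ : ℕ} (hrec : MultOddFirstUnitIndexAt W p n₀) (n : ℕ)
    (hA : ∀ (κ : ZpExtension ℚ p), κ.IsCyclotomic →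
      ∃ s : Finset {y : W.selmerInftyPreimage κ n // p • y = 0}, p ^ n₀ ≤ s.card) : BSDp W p :=
  hX.bsdp_rankZero_of_wuthrichHalf_of_firstUnitIndex_of_budget_odd hW16 hDel hDelX hGZK hmod hmodD hp4 hr
    hrec (budgetLeLambdaAt_of_prop414_of_layerClasses h414 htors n hA)

/-- **`p = 3` (the N10 X3♯(M) rows at `3`)**: X3♯(M)@3 ∧ `r_an = 0`, record `MultOddFirstUnitIndexAt W 3 n₀`,
`h414` + `3 ∤ #E(ℚ)_tors`, p10's level-`n` count (`ℚ_1 = ℚ(ζ_9)⁺` at `n = 1`) ⟹ `BSD(E,3)`.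
[cite: Wuthrich2014, Thm. 16 (p. 397)] [cite: Delbourgo1998, Prop. 4 (p. 144)]
[cite: GreenbergLNM1716, Prop. 4.14 (p. 114)] [cite: Miller2011LMS, Def. 1.1] -/
theorem ClassX3M.bsdp_three_rankZero_of_wuthrichHalf_of_firstUnitIndex_of_prop414_of_layerClasses
    [Fact (Nat.Prime 3)] {W : WeierstrassCurve ℚ} [W.IsElliptic] [W.IsGloballyMinimal]
    (hW16 : Wuthrich2014.thm16_halfEigenCharIdeal_dvd_cyclotomicPrime)
    (hDel : Delbourgo1998.prop4_rankZero_pow_dvd_constantCoeff)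
    (hDelX : Delbourgo1998.prop4_rankZero_constantCoeff_eq_unit_mul_of_potMult)
    (h414 : Greenberg1999.prop414_noFiniteSubmodule_of_not_dvd_torsionOrder)
    (hGZK : rank_eq_analyticRank_of_analyticRank_le_one) (hmod : hasEntireLFunction_rat)
    (hmodD : nonempty_modularParametrizationData)
    (hX : ClassX3M W 3) (hr : W.analyticRank = 0) (htors : ¬ 3 ∣ W.torsionOrder) {n₀ : ℕ}
    (hrec : MultOddFirstUnitIndexAt W 3 n₀) (n : ℕ)
    (hA : ∀ (κ : ZpExtension ℚ 3), κ.IsCyclotomic →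
      ∃ s : Finset {y : W.selmerInftyPreimage κ n // 3 • y = 0}, 3 ^ n₀ ≤ s.card) : BSDp W 3 :=
  hX.bsdp_rankZero_of_wuthrichHalf_of_firstUnitIndex_of_prop414_of_layerClasses_odd hW16 hDel hDelX
    h414 hGZK hmod hmodD (by decide) hr htors hrec n hA

/-- **The (b′) form on rows with RATIONAL `p`-TORSION** (where the Prop. 4.14 record is silent): X3♯(M)
∧ `r_an = 0`, EVERY odd `p`, record at `n₀` + `hnf : NoFiniteSubmoduleAt p W` (e.g. Greenberg Prop. 4.15
(i): an additive prime `v₀ ∤ p`, when typed) + `p ∤ #E(ℚ)_tors` for the injection + p10's level-`n` count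
⟹ `BSD(E,p)` (`budgetLeLambdaAt_of_noFiniteSubmodule_of_layerClasses`).
[cite: Wuthrich2014, Thm. 16 (p. 397)] [cite: Delbourgo1998, Prop. 4 (p. 144)] [cite: Pal2012, Thm. 3.2]
[cite: GreenbergLNM1716, Prop. 4.15 (i) (shape of the intended discharge of hnf)] [cite: Miller2011LMS, Def. 1.1] -/
theorem ClassX3M.bsdp_rankZero_of_wuthrichHalf_of_firstUnitIndex_of_noFiniteSubmodule_of_layerClasses
    (hW16 : Wuthrich2014.thm16_halfEigenCharIdeal_dvd_cyclotomicPrime)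
    (hDel : Delbourgo1998.prop4_rankZero_pow_dvd_constantCoeff)
    (hDelX : Delbourgo1998.prop4_rankZero_constantCoeff_eq_unit_mul_of_potMult)
    (hPal : Pal2012.thm32_sqrt_mul_realPeriodRat_twist_eq_of_prime_one_mod_four)
    (hGZK : rank_eq_analyticRank_of_analyticRank_le_one) (hmod : hasEntireLFunction_rat)
    (hmodD : nonempty_modularParametrizationData)
    (hX : ClassX3M W p) (hr : W.analyticRank = 0) (htors : ¬ p ∣ W.torsionOrder)
    (hnf : NoFiniteSubmoduleAt p W) {n₀ : ℕ}
    (hrec : (p % 4 = 1 → MultFirstUnitIndexAt W p n₀) ∧ (p % 4 = 3 → MultOddFirstUnitIndexAt W p n₀))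
    (n : ℕ) (hA : ∀ (κ : ZpExtension ℚ p), κ.IsCyclotomic →
      ∃ s : Finset {y : W.selmerInftyPreimage κ n // p • y = 0}, p ^ n₀ ≤ s.card) : BSDp W p :=
  hX.bsdp_rankZero_of_wuthrichHalf_of_firstUnitIndex_of_budget hW16 hDel hDelX hPal hGZK hmod hmodD hr
    hrec (budgetLeLambdaAt_of_noFiniteSubmodule_of_layerClasses htors hnf n hA)

/-! ### §2 Rank `1`: the Route-G capstone and the census-column headline over the level-`n` count -/

/-- **X3♯(M) Route-G CAPSTONE with the budget from the level-`n` count**: X3♯(M) ∧ `r_an = 1`, EVERY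
odd `p`: from `hW16`, `hDelM`, modularity, GZK, the record at `n₀`, `h414` + `p ∤ #E(ℚ)_tors`, p10's
count `hA`, and the non-vanishing bit `hne`: `BSD(E,p) ⟺ ∀ (B)-data, the typed p-adic Gross–Zagier
formula` (gen-2's `…_of_firstUnitIndex_of_budget` with `hbud` supplied).
[cite: Wuthrich2014, Thm. 16 (p. 397)] [cite: Delbourgo2002, Theorem (A), (B) (p. 40)]
[cite: GreenbergLNM1716, Prop. 4.14 (p. 114)] [cite: Miller2011LMS, Def. 1.1] -/
theorem ClassX3M.bsdp_iff_forall_branchPAdicGrossZagierMultAt_of_wuthrichHalf_of_firstUnitIndex_of_prop414_of_layerClasses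
    (hDelM : Delbourgo2002.mainTheorem_potMult)
    (hW16 : Wuthrich2014.thm16_halfEigenCharIdeal_dvd_cyclotomicPrime)
    (h414 : Greenberg1999.prop414_noFiniteSubmodule_of_not_dvd_torsionOrder)
    (hmod : hasEntireLFunction_rat) (hmodD : nonempty_modularParametrizationData)
    (hGZK : rank_eq_analyticRank_of_analyticRank_le_one)
    (hX : ClassX3M W p) (hr : W.analyticRank = 1) (htors : ¬ p ∣ W.torsionOrder) {n₀ : ℕ}
    (hrec : (p % 4 = 1 → MultFirstUnitIndexAt W p n₀) ∧ (p % 4 = 3 → MultOddFirstUnitIndexAt W p n₀))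
    (n : ℕ) (hA : ∀ (κ : ZpExtension ℚ p), κ.IsCyclotomic →
      ∃ s : Finset {y : W.selmerInftyPreimage κ n // p • y = 0}, p ^ n₀ ≤ s.card)
    (hne : ∀ (V : WeierstrassCurve ℚ) [V.IsElliptic] [V.IsGloballyMinimal] (C : VariableChange ℚ),
      Mult V p → C • V.quadraticTwist ((-1 : ℚ) ^ (p / 2) * p) = W →
      ∀ {N : ℕ} [NeZero N] (f : CuspForm (Gamma0 N) 2), IsNewformOf V f → ∀ (ap : ℤ), cuspCoeff f p = ap →
      ∀ ϖ : ℚ, (if Even (p / 2) then (ϖ : ℝ) * V.realPeriodRat = plusPeriod f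
          else (ϖ : ℝ) * V.imaginaryPeriodRat = minusPeriod f) →
        PowerSeries.coeff 1 (PowerSeries.C (ϖ : ℚ_[p]) *
            (if Even (p / 2) then padicLFunctionPlusBranchMult f (ap : ℚ_[p]) (p / 2)
              else padicLFunctionMinusBranchMult f (ap : ℚ_[p]) (p / 2))) ≠ 0) :
    BSDp W p ↔
      ∀ Dh : PAdicHeightData W p, LeadingTermClauses W p Dh → BranchPAdicGrossZagierMultAt W p Dh :=
  hX.bsdp_iff_forall_branchPAdicGrossZagierMultAt_of_wuthrichHalf_of_firstUnitIndex_of_budget hDelM hW16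
    hmod hmodD hGZK hr hrec (budgetLeLambdaAt_of_prop414_of_layerClasses h414 htors n hA) hne

/-- **HEADLINE with the census COLUMN over the level-`n` count (X3♯(M) ∧ `r_an = 1`, EVERY odd `p`):
`BSD(E,p) ⟺ ord_p q + ord_p Reg_p(E,Dh) = 1 + v₁`** for every (B)-datum `Dh`
(`L'(E,1) = q·Ω_E·Reg_∞(E)`, `v₁` = census-ctyper1's column `MultCoeffValAt W p 1 v₁`), from `hW16`,
the record at `n₀`, `h414` + `p ∤ #E(ℚ)_tors` and p10's count `hA`.
[cite: Wuthrich2014, Thm. 16 (p. 397)] [cite: Delbourgo2002, Theorem (B) (p. 40)]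
[cite: GreenbergLNM1716, Prop. 4.14 (p. 114)] [cite: Miller2011LMS, Def. 1.1] -/
theorem ClassX3M.bsdp_iff_padicVal_rankOne_of_wuthrichHalf_of_firstUnitIndex_of_multCoeffValAt_of_prop414_of_layerClasses
    (hW16 : Wuthrich2014.thm16_halfEigenCharIdeal_dvd_cyclotomicPrime)
    (h414 : Greenberg1999.prop414_noFiniteSubmodule_of_not_dvd_torsionOrder)
    (hmodD : nonempty_modularParametrizationData)
    (hGZK : rank_eq_analyticRank_of_analyticRank_le_one) (hmod : hasEntireLFunction_rat)
    (hX : ClassX3M W p) (hr : W.analyticRank = 1) (htors : ¬ p ∣ W.torsionOrder) {n₀ : ℕ}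
    (hrec : (p % 4 = 1 → MultFirstUnitIndexAt W p n₀) ∧ (p % 4 = 3 → MultOddFirstUnitIndexAt W p n₀))
    (n : ℕ) (hA : ∀ (κ : ZpExtension ℚ p), κ.IsCyclotomic →
      ∃ s : Finset {y : W.selmerInftyPreimage κ n // p • y = 0}, p ^ n₀ ≤ s.card)
    {v₁ : ℤ} (hv : MultCoeffValAt W p 1 v₁) {Dh : PAdicHeightData W p} (hB : LeadingTermClauses W p Dh)
    {q : ℚ} (hLq : W.leadingLCoeff = (q : ℂ) * (W.realPeriodRat : ℂ) * (W.regulator : ℂ)) :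
    BSDp W p ↔ padicValRat p q + (padicRegulator Dh).valuation = 1 + v₁ :=
  hX.bsdp_iff_padicVal_rankOne_of_wuthrichHalf_of_firstUnitIndex_of_multCoeffValAt_of_budget hW16 hmodD
    hGZK hmod hr hrec (budgetLeLambdaAt_of_prop414_of_layerClasses h414 htors n hA) hv hB hLq

/-- **`p = 3` HEADLINE with the column over the level-`n` count**: X3♯(M) ∧ `r_an = 1` at `3`, record
`MultOddFirstUnitIndexAt W 3 n₀`, column `MultCoeffValAt W 3 1 v₁`, `h414` + `3 ∤ #E(ℚ)_tors`, p10's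
count ⟹ `BSD(E,3) ⟺ ord_3 q + ord_3 Reg_3(E,Dh) = 1 + v₁`.
[cite: Wuthrich2014, Thm. 16 (p. 397)] [cite: Delbourgo2002, Theorem (B) (p. 40)] [cite: GreenbergLNM1716, Prop. 4.14 (p. 114)] -/
theorem ClassX3M.bsdp_three_iff_padicVal_rankOne_of_wuthrichHalf_of_firstUnitIndex_of_multCoeffValAt_of_prop414_of_layerClasses
    [Fact (Nat.Prime 3)] {W : WeierstrassCurve ℚ} [W.IsElliptic] [W.IsGloballyMinimal]
    (hW16 : Wuthrich2014.thm16_halfEigenCharIdeal_dvd_cyclotomicPrime)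
    (h414 : Greenberg1999.prop414_noFiniteSubmodule_of_not_dvd_torsionOrder)
    (hmodD : nonempty_modularParametrizationData)
    (hGZK : rank_eq_analyticRank_of_analyticRank_le_one) (hmod : hasEntireLFunction_rat)
    (hX : ClassX3M W 3) (hr : W.analyticRank = 1) (htors : ¬ 3 ∣ W.torsionOrder) {n₀ : ℕ}
    (hrec : MultOddFirstUnitIndexAt W 3 n₀) (n : ℕ)
    (hA : ∀ (κ : ZpExtension ℚ 3), κ.IsCyclotomic →
      ∃ s : Finset {y : W.selmerInftyPreimage κ n // 3 • y = 0}, 3 ^ n₀ ≤ s.card)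
    {v₁ : ℤ} (hv : MultCoeffValAt W 3 1 v₁) {Dh : PAdicHeightData W 3} (hB : LeadingTermClauses W 3 Dh)
    {q : ℚ} (hLq : W.leadingLCoeff = (q : ℂ) * (W.realPeriodRat : ℂ) * (W.regulator : ℂ)) :
    BSDp W 3 ↔ padicValRat 3 q + (padicRegulator Dh).valuation = 1 + v₁ :=
  hX.bsdp_iff_padicVal_rankOne_of_wuthrichHalf_of_firstUnitIndex_of_multCoeffValAt_of_prop414_of_layerClasses
    hW16 h414 hmodD hGZK hmod hr htors ⟨fun h ↦ absurd h (by norm_num), fun _ ↦ hrec⟩ n hA hv hB hLq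

end Summit.BirchSwinnertonDyer.Rank1Residual.AdditivePotMult

end
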